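import Literature.MathematicalPhysics.QuantumFieldTheory.Balaban1983to89.B9Eq371Composition

/-!
# `Balaban1983to89.B9Eq375Composition` — B9, p. 405, display (3.75): the `DD*` SIDE of the expansion,
# `D_{U′U}D*_{U′U}A′ = D_U D*_U A′ − V₂(A)A′`, with the print's seven-term first-order bracket VERBATIM, the higher-order operator
# `F_{2,k}(A)` made EXPLICIT, and «the bounds (3.72), (3.73)» for `F₂`, `V₂` with every `O(1)` explicit; kernel-checked; v1.1
# (v1 = p191250; v1.1 docstring only: the (3.37) quotation completed — XREAD adv9-g63, journal l.57545, D-1)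

CITATION HEADER (lean-in-tree rule).  Audit cell `pub-balaban`, surge node-prover lineage pv27 (B9 pp. 390–392, 396–397, 404–405),
unit `b2b-balaban-pv27-g19` (journal CLAIM l.57003, node B9-EQ375-COMPOSITION; first node of the seat; successor of the pv27-g18 leaves
`B9Eq369Product` (v1.1 p190342), `B9Eq370Expansion` (v1.1 p190343), `B9Eq371Composition` (p190660), `B9Eq372Locality` (p190900)).
Source: T. Bałaban, *Propagators for lattice gauge theories in a background field*, Commun. Math. Phys. **99** (1985) 389–434
[Balaban1985BackgroundPropagators] (cell paper B9; journal page = PDF page + 388), p. 405 [PDF 17] (displays (3.74), (3.75) and the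
sentence between (3.75) and (3.76)), with (3.72), (3.73) (same page), (3.37) p. 396 [PDF 8] and (3.39) p. 397 [PDF 9], quoted from the
page render `b2b-balaban-ref1/pages/1985-cmp99-background-propagators/…-p017-x2.png` READ AS AN IMAGE by this seat (2026-08-19).  The
verbatim transcription of (3.70)–(3.74) with its [sic] marks is in the header of `B9Eq370Expansion`, that of (3.71)–(3.73) in
`B9Eq371Composition` (the single import); (3.2)–(3.12) are quoted in `B9Eq37Insertion`/`B9Eq39Adjoint`/`B9Eq310Hermitian`,
(3.35)/(3.37)/(3.39) in `B9Eq369Small` — all imported BY NAME, transitively.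

HONEST FRAMING (cell charter, verbatim in substance).  The cell audits Bałaban's papers; discharging its end statements would
make Bałaban's ultraviolet stability theorem unconditional inside this package — a constructive-QFT statement; it is NOT the
continuum limit and NOT the Clay problem.  THIS FILE DISCHARGES NOTHING of the series: it is non-commutative bookkeeping — the
composition of two first-order expansions of conjugations in a Banach algebra and the triangle inequality — on the lineage's lattice
carrier (`B9Eq39Adjoint`: `R W X = WXW⁻¹`, `covD`, `covDstar`, `divB`, `prodCfg U η A = (b ↦ e^{iηA(b)}·U(b))`), consuming BY NAME the
per-transport identities and remainder bounds of `B9Eq370Expansion` (`covD_prodCfg_expand` = (3.70) for one derivative,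
`covDstar_prodCfg_expand` = (3.74) for one direction, `conjRem`, `norm_conjRem_le_sq`, `R_Iη_smul`, `norm_Iη_smul`), the regrouping
lemma and monotone norm forms of `B9Eq371Composition` (`R_ad`, `norm_R_le_sq`, `norm_ad_le_of_le`, `norm_conjRem_le_of_le`,
`covDstar_eq_neg_R_covD`) and the commutator `ad` of `Beta.BackgroundVertices`.  Value = kernel certificate that (3.75) is an IDENTITY
on the abstract carrier (arbitrary units `U(b)`, arbitrary bijections as shifts, no commutativity, no `‖1‖ = 1`) with the print's
seven-term bracket letter for letter — the composition «(3.70) on the outside ∘ (3.74) on the inside» first gives a THREE-TERM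
first-order form per direction (`tBracket₂`, not displayed in print), and the print's seven terms are its EXACT regrouping, term by term
in `ν` (`tBracket₂_eq_sBracket₂`) — once the higher-order operator `F_{2,k}(A)`, which the print does not write out, is given the explicit
closed form `F₂op` below; and that «the bounds (3.72), (3.73)» hold for `F₂`, `V₂` with explicit constants under uniform sup hypotheses.
NOT summit progress.

ABSOLUTE RULE.  No internally-minted statement enters as a cited fact.  Every declaration below is PROVED (tags `[folklore]`);
the `[cite: …]` tags document WHICH PRINTED DISPLAY a definition or a proved statement transcribes — the proofs are ours, the
print is not used as a hypothesis anywhere.  The regularity input (3.37) enters the three `_printed` corollaries as HYPOTHESES on the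
letters (`‖A(b)‖ ≤ a ≤ α₁(L^jη)⁻¹`, `‖(D¹A)(b)‖ ≤ g ≤ η·α₁(L^jη)⁻²`) with `α₁`, `L ≥ 1`, `η > 0`, `j` as binders.

LETTERS AND NORMALISATION (as `B9Eq370Expansion`, `B9Eq371Composition`).  p. 404–405 RENAME the letters of (3.37): the exponent
field of `U′ = e^{iηA}` is `A`, and `A′` is the ARGUMENT the operators act on; `prodCfg U η A = U′U`.  `D¹_μ := covD = η·D_μ`,
`D¹*_ν := covDstar = η·D*_ν`, `D¹* := divB = Σ_ν D¹*_ν` ((3.8): `(D*A′)(x) = Σ_ν (D*_νA′_ν)(x)`, a site function); the print's `iad_{A}`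
(its factor `η` from «R(U′) = exp ηiad_A» suppressed in (3.75) as in the last expression of (3.71)) is `ad (iη·A)` (`ad b Z = bZ − Zb`).
Hence every object of this file is `η²` × the printed one: `gradDiv = η²·(DD*A′)_μ(x)`, `sBracket₂_ν = η²·[seven-term bracket]_ν`,
`F₂op = η²·(F_{2,k}(A)A′)_μ(x)`, `V₂op = η²·(V₂(A)A′)_μ(x)`.  Geometry through (3.5): `x + e_μ = T μ x`, `x − e_ν = (T ν).symm x`,
`U(x, x+e_μ) = U_μ(x)`, `U(x, x−e_ν) = U_ν(x−e_ν)⁻¹`, `U(x+e_μ, x+e_μ−e_ν) = U_ν(x+e_μ−e_ν)⁻¹` with `x+e_μ−e_ν = (T ν).symm (T μ x)`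
(NO commutation of shifts is assumed or needed: the letter is reached from `x+e_μ` backwards along `ν`, exactly as printed).

WHAT IS IN PRINT (p. 405 [PDF 17]; «…» verbatim from the render).  After (3.73) and its norm sentence (quoted in `B9Eq371Composition`):
«Next we consider the operator DRD*. We have discussed already the expansion (3.68) of the operator P(U′U), so we have to consider the
differential operators again. We have
(D*_{U′U}A′)(x) = (D*_U A′)(x) + Σ_{ν=1}^d η⁻¹[exp(−ηiad_{R(U(x,x−ηe_ν))A_ν(x−ηe_ν)}) − 1]·R(U(x, x − ηe_ν))A′_ν(x − ηe_ν), (3.74)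
(D_{U′U}D*_{U′U}A′)_μ(x) = (D_U D*_U A′)_μ(x) − Σ_{ν=1}^d [− iad_{A_μ(x)}R(U(x, x + ηe_μ))(D*_νA′_ν)(x + ηe_μ)
+ R(U(x, x + ηe_μ))iad_{A_ν(x+ηe_μ)}(D*_νA′_ν)(x + ηe_μ) − iad_{A_ν(x)}(D*_νA′_ν)(x) + iad_{A_ν(x)}(D_μA′_ν)(x)
+ iad_{(D_μA_ν)(x)}R(U(x, x + ηe_μ))A′_ν(x + ηe_μ) + R(U(x, x + ηe_μ))iad_{(D*_νA_ν)(x+ηe_μ)}·R(U(x + ηe_μ, x + ηe_μ − ηe_ν))A′_ν(x + ηe_μ − ηe_ν)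
− iad_{(D*_νA_ν)(x)}R(U(x, x − ηe_ν))A′_ν(x − ηe_ν)] − (F_{2,k}(A)A′)_μ(x) = (DD*A′)_μ(x) − (V₂(A)A′)_μ(x), (3.75)
where the operators F_{2,k}(A), V₂(A) satisfy the bounds (3.72), (3.73). These expansions imply the following one:» — then (3.76)
(`D_{U′U}R(U′U)D*_{U′U} = … = DRD* − V₂(A) − P₁(A)`, NOT transcribed here: it involves `P(U)`, `P′(A)` of (3.68), outside this file).
(3.72): «|(F_{1,k}(A)A′)_μ(x)| ≤ O(1)|A|²|A′| ≤ O(1)α₁²(L^jη)⁻²|A′|, b ∈ Ω_j (3.72) with the same norms |A|, |A′| determined by the set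
st(b) as in (3.69).»; (3.73): «|(V₁(A)A′)(b)| ≤ O(1)(|A||∇A′| + |∇A||A′| + |A|²|A′|) ≤ O(1)α₁((L^jη)⁻¹|∇A′| + (L^jη)⁻²|A′|), b ∈ Ω_j,
(3.73) with the same conditions on norms as above. The derivatives are, of course, the covariant derivatives defined by U. The constant
O(1) is an absolute constant depending on d only.»; (3.39), p. 397: «|A| = max_μ sup_x |A_μ(x)|, |∇A| = max_{μ,ν} sup_x |(D_μA_ν)(x)|»;
(3.37), p. 396: «|A′| < α₁(L^jη)⁻¹, |∇^η_U A′| < α₁(L^jη)⁻² on Ω_j, j = 0, …, k;».  READING FIXED BY THE PRINT (as for `V₁` in (3.71)): the last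
equality of (3.75) has no separate `F` term, so `(V₂(A)A′)_μ(x) := Σ_ν[seven-term bracket]_ν + (F_{2,k}(A)A′)_μ(x)` — first AND higher
orders in `A` (whence the `|A|²|A′|` of (3.73)); `V₂op` below is typed exactly so.  NO print slip was found in (3.75): the kernel confirms
the seven-term bracket letter for letter (signs, arguments, transports), see `tBracket₂_eq_sBracket₂`.

WHAT THIS FILE PROVES.  MODEL (as in the lineage leaves): `𝔸` a complete normed ℂ-algebra; sites `S`, directions `ι` (`Fintype` where
`Σ_ν` occurs), shifts `T ν : S ≃ S` (NO commutation assumed), background `U : ι → S → 𝔸ˣ` (ARBITRARY units), exponent field `A`, argument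
`A′ : ι → S → 𝔸`; norms = the `NormedRing` norm.
* §1 ALGEBRA: `R_sum` (transport of a finite sum), `covD_sum` (covariant difference of a finite sum of site functions).
* §2 OBJECTS: **`gradDiv`** `= Σ_ν D¹_μ(D¹*_νA′_ν)` — the left side `(D¹D¹*A′)_μ(x)` of (3.75) for ANY configuration in the slot of `U`
  (`covD_divB_eq_gradDiv`: it IS `D¹_μ` of the site divergence `D¹*A′ = divB` of (3.8)); **`divE₁`**, **`divE₂`** — the first-order vertex
  `iη[a′_ν(z), W_ν(z)]` and the remainder `𝓕(−iηa′_ν(z), W_ν(z))` of (3.74) for `G = A′_ν` (`a′_ν(z) = R(U(z,z−e_ν))A_ν(z−e_ν)`,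
  `W_ν(z) = R(U(z,z−e_ν))A′_ν(z−e_ν)`, `𝓕 = conjRem`); **`tBracket₂`** — the THREE-TERM first-order form of the composition per direction
  (outer vertex on the transported `D¹*_νA′_ν`, transported inner vertex at `x+e_μ`, inner vertex at `x`; not displayed in print);
  **`sBracket₂`** = the print's SEVEN-TERM bracket, letters verbatim (docstring); **`fRem₂`**, **`F₂op = −Σ_ν fRem₂_ν`** — the EXPLICIT
  `F_{2,k}(A)A′`: per direction `D¹_{U,μ}(E₂)(x) + [b_μ, R(U_μ(x))(E₂ − E₁)(x+e_μ)] + 𝓕(b_μ, R(U_μ(x))(D¹*_{U′U,ν}A′_ν)(x+e_μ))`,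
  `b_μ = iηA_μ(x)` (every summand a product of ≥ 2 expansion letters); **`V₂op = Σ_ν sBracket₂_ν + F₂op`** (the print's `V₂(A)A′`).
* §3 (3.75) AS KERNEL IDENTITIES: `covDstar_prodCfg_split` ((3.74) for `G = A′_ν`, split by order: `covDstar_prodCfg_expand` BY NAME);
  **`covD_covDstar_prodCfg`** — PER DIRECTION `ν`: `D¹_{U′U,μ}(D¹*_{U′U,ν}A′_ν)(x) = D¹_{U,μ}(D¹*_{U,ν}A′_ν)(x) − tBracket₂_ν(x) + fRem₂_ν(x)`;
  `gradDiv_prodCfg_eq_tBracket₂` (summed: `= gradDiv − Σ_ν tBracket₂_ν − F₂op`); **`tBracket₂_eq_sBracket₂`** — the three-term form EQUALS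
  the printed seven-term bracket, EXACTLY and per direction (`R(V)[b, Z] = [R(V)b, R(V)Z]` = `R_ad`; every transported letter split as
  covariant difference + local letter: `a′_ν(z) = (D¹*_νA_ν)(z) + A_ν(z)`, `W_ν(z) = (D¹*_νA′_ν)(z) + A′_ν(z)`, `R(U_μ(x))A_ν(x+e_μ) =
  (D¹_μA_ν)(x) + A_ν(x)`); `gradDiv_prodCfg_eq_sBracket₂`; **`gradDiv_prodCfg`** — (3.75): `gradDiv T (prodCfg U η A) A′ μ x = gradDiv T U
  A′ μ x − V₂op T U η A A′ μ x`; **`covD_divB_prodCfg`** — the same with the print's literal left side `D¹_{U′U,μ}(D¹*_{U′U}A′)`.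
* §4 «THE BOUNDS (3.72), (3.73)» FOR `F₂`, `V₂`, `O(1)` EXPLICIT, under UNIFORM sups `‖A_κ(z)‖ ≤ a`, `‖A′_κ(z)‖ ≤ a′`, `‖(D¹_κA_τ)(z)‖ ≤ g`,
  `‖(D¹_κA′_τ)(z)‖ ≤ g′` (all `κ, τ, z` — in place of the sups over `st(b)`) and TRANSPORT SIZE `‖U(b)‖, ‖U(b)⁻¹‖ ≤ ρ`, `ρ ≥ 1` (`ρ = 1`: a
  `G`-valued background in an operator norm); `s := ηρ²a`, `d := |ι|`:  `norm_divE₁_le`, `norm_divE₂_le`, `norm_covDstar_le_of`,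
  `norm_covDstar_prodCfg_le` (letter-level, abstract sizes); `norm_fRem₂_le_of` (abstract sizes) and **`norm_fRem₂_le`**: `‖fRem₂_ν(x)‖ ≤
  4ρ⁴s²e^{2s}(3 + 2s + s²e^{2s})·a′` (HALF the curl-side constant of `B9Eq371Composition.norm_fRem_le`: one transported letter per direction
  instead of two); **`norm_F₂op_le`** — (3.72) for `F₂`, first inequality: `‖(F₂(A)A′)_μ(x)‖ ≤ d·4ρ⁴s²e^{2s}(3 + 2s + s²e^{2s})·a′` (= `η²·
  O(1)|A|²|A′|`); **`norm_F₂op_le_printed`** — second inequality at `ρ = 1` under (3.37): `≤ d·4e^{2α₁}(3 + 2α₁ + α₁²e^{2α₁})·α₁²·L^{−2j}·a′`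
  (= `η²·O(1)α₁²(L^jη)⁻²|A′|`); `norm_sBracket₂_le` (`‖sBracket₂_ν(x)‖ ≤ η((4ρ⁴ + 2ρ² + 2)ag′ + 2ρ²(1 + ρ² + ρ⁴)ga′)`), `norm_sum_sBracket₂_le`,
  `norm_sum_sBracket₂_le_printed` (first-order part: `≤ 2dα₁(4L^{−j}g′ + 3L^{−2j}a′)`); **`norm_V₂op_le`** — (3.73) for `V₂`, first inequality,
  all three printed terms: `‖(V₂(A)A′)_μ(x)‖ ≤ d·[η((4ρ⁴ + 2ρ² + 2)ag′ + 2ρ²(1 + ρ² + ρ⁴)ga′) + 4ρ⁴s²e^{2s}(3 + 2s + s²e^{2s})a′]`;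
  **`norm_V₂op_le_printed`** — second inequality at `ρ = 1` under (3.37): `≤ d·α₁·[8L^{−j}g′ + (6 + 4α₁e^{2α₁}(3 + 2α₁ + α₁²e^{2α₁}))L^{−2j}a′]`
  (= `η²·O(1)α₁((L^jη)⁻¹|∇A′| + (L^jη)⁻²|A′|)` with `g′ = η|∇A′|`; for `α₁ ≤ 1` the bracket's constants are absolute, «depending on d only»
  through the factor `d`).
* §5 SANITY (`example`s): `A = 0 ⟹ sBracket₂ = fRem₂ = V₂op = 0` and `gradDiv(U′U) = gradDiv(U)` (`prodCfg_zero`); over a COMMUTATIVE carrier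
  `sBracket₂ ≡ 0` (the first-order operator is a sum of commutators).

RELATED IN THE TREE, NOT DUPLICATED (searched 2026-08-19: MODULE-MAP rows B9/B12/Beta; `grep -rn "(3.75)\|V₂(A)\|F_{2,k}\|DRD\*" Balaban1983to89/`
— (3.75)/`V₂(A)`/`F_{2,k}` occur only in NOT-PROVED lists (`B9Eq370Expansion`, `B9Eq371Composition`, `B9Eq372Locality`) and, as King's (3.75),
in `T4EtaRate` (a different paper); `DRD*` occurs in the Sect. D/E matrix files `B9Eq3112`, `B9Eq3152` as an abstract summand of `G⁻¹ = Δ_π +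
DRD* + Q*aQ` over real matrices — a different object, no expansion in `A`): `B9Eq370Expansion` = (3.70)/(3.74) per transport and
`B9Eq371Composition` = (3.71) (the `D*D` side, `V₁`, `F_{1,k}`), consumed here BY NAME; `Beta.BackgroundVertices` — only `ad`, `ad_*`,
`norm_ad_le`, BY NAME.  Nothing in the tree states (3.75), types `V₂(A)`/`F_{2,k}(A)` of B9, or proves (3.72)/(3.73) for them.

NOT PROVED HERE, NOT CLAIMED: (3.76) and the expansion (3.68) of `P(U′U)` (`P(U)`, `P′(A)`, `P₁(A)`); the LOCALITY clause («a local, bounded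
operator», norms «determined by the set st(b) as in (3.69)», `b ∈ Ω_j`) — the bounds are typed with UNIFORM sups over all bonds and the
scale-`j` constants as binders, no `Ω_j`/`st(b)` geometry (reading note, not formalised: unlike (3.71), the `ν = μ` summand of (3.75) does
NOT vanish, and its letters `A_μ(x ± ηe_μ)`, `A′_μ(x ± ηe_μ)` sit on bonds COLLINEAR with `b = ⟨x, x+ηe_μ⟩`, so the set of bonds whose
letters enter `(V₂(A)A′)(b)` is the set of bonds sharing a SITE with `b` or with `b + ηe_μ`, not only `∪_{p ∈ st(b)}∂p`; immaterial for the
`O(1)` bounds as typed); the print's identification of the conjugation `R(e^{iηA})` with the power series `exp(ηiad_A)` (typed, as in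
`B9Eq370Expansion`, as the conjugation and its explicit remainder `conjRem`; `Ad∘exp = exp∘ad` is not formalised and not needed); uniqueness
of the splitting «first order + remainder» (the print fixes `F_{2,k}` only through «satisfy the bounds (3.72), (3.73)»; `F₂op` is ONE closed
form making (3.75) an identity with the printed bracket, and it is `O(|A|²|A′|)` as (3.72) demands); any statement in the normalised
Hilbert–Schmidt norm of p. 392 (cell DIVERGENCE D-1: all bounds are in the abstract `NormedRing` norm; a unitary `G`-valued background is
the case `ρ = 1`).  Records: GAPS C-pv27-75, DIVERGENCE D-pv27.11 (modelling divergences only: uniform sups, transport size `ρ`, `V₂ ⊇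
F_{2,k}` reading as printed, locality-set note; NO print slip found in (3.74)–(3.75)).  NOT summit progress.
-/

noncomputable section

namespace Literature.MathematicalPhysics.QuantumFieldTheory.Balaban1983to89.B9Eq375Composition

open NormedSpace Complex
open Literature.MathematicalPhysics.QuantumFieldTheory.Balaban1983to89
open Literature.MathematicalPhysics.QuantumFieldTheory.Balaban1983to89.Beta.TransportVertices
open Literature.MathematicalPhysics.QuantumFieldTheory.Balaban1983to89.Beta.BackgroundVertices
  (ad ad_apply norm_ad_le ad_add_left ad_add_right ad_sub_left ad_sub_right ad_neg_left ad_smul_left)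
open Literature.MathematicalPhysics.QuantumFieldTheory.Balaban1983to89.B9Eq37Insertion
open Literature.MathematicalPhysics.QuantumFieldTheory.Balaban1983to89.B9Eq39Adjoint
open Literature.MathematicalPhysics.QuantumFieldTheory.Balaban1983to89.B9Eq369Product
open Literature.MathematicalPhysics.QuantumFieldTheory.Balaban1983to89.B9Eq370Expansion
open Literature.MathematicalPhysics.QuantumFieldTheory.Balaban1983to89.B9Eq371Composition

/-! ## §1  Algebra: transport and covariant difference of a finite sum -/

section Algebra

variable {𝔸 : Type*} [Ring 𝔸]

/-- Transport is additive over finite sums: `R(V)(Σ_i X_i) = Σ_i R(V)X_i`. [folklore] -/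
theorem R_sum {κ : Type*} (V : 𝔸ˣ) (s : Finset κ) (X : κ → 𝔸) :
    R V (∑ i ∈ s, X i) = ∑ i ∈ s, R V (X i) := by
  simp only [R_def, Finset.mul_sum, Finset.sum_mul]

variable {S : Type*} {ι : Type*} (T : ι → Equiv.Perm S) (U : ι → S → 𝔸ˣ)

/-- The covariant difference of a finite sum of site functions is the sum of the covariant differences. [folklore] -/
theorem covD_sum {κ : Type*} (s : Finset κ) (μ : ι) (F : κ → S → 𝔸) (x : S) :
    covD T U μ (fun z => ∑ i ∈ s, F i z) x = ∑ i ∈ s, covD T U μ (F i) x := by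
  simp only [covD, R_sum, Finset.sum_sub_distrib]

end Algebra

/-! ## §2  The objects of (3.75) on the carrier (`η²`-normalisation: `D¹ = ηD`, `D¹* = ηD*`, the expansion parameter `iη` inside `ad`) -/

section Objects

variable {𝔸 : Type*} [NormedRing 𝔸] [NormedAlgebra ℂ 𝔸] [CompleteSpace 𝔸] {S : Type*} {ι : Type*}
variable (T : ι → Equiv.Perm S) (U : ι → S → 𝔸ˣ)

/-- `(D¹D¹*A′)_μ(x) = Σ_ν (D¹_μ (D¹*_ν A′_ν))(x)` — the LEFT SIDE of (3.75), for ANY configuration in the slot of `U`; it is `D¹_μ` of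
the site divergence `(D¹*A′)(x) = Σ_ν (D¹*_νA′_ν)(x)` of (3.8) (`covD_divB_eq_gradDiv`). [folklore]
[cite: Balaban1985BackgroundPropagators, (3.75) p.405, (3.8) p.392] -/
def gradDiv [Fintype ι] (A' : ι → S → 𝔸) (μ : ι) (x : S) : 𝔸 := ∑ ν, covD T U μ (covDstar T U ν (A' ν)) x

/-- FIRST-ORDER PART of `(D¹*_{U′U,ν}A′_ν)(z) − (D¹*_{U,ν}A′_ν)(z)` ((3.74), direction `ν`): the vertex `iη[a′_ν(z), W_ν(z)]`,
`a′_ν(z) = R(U(z, z−e_ν))A_ν(z−e_ν)`, `W_ν(z) = R(U(z, z−e_ν))A′_ν(z−e_ν)` (it enters (3.74) with a MINUS sign: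
«exp(−ηiad_{R(U(x,x−ηe_ν))A_ν(x−ηe_ν)}) − 1»). [folklore] [cite: Balaban1985BackgroundPropagators, (3.74) p.405] -/
def divE₁ (η : ℝ) (A A' : ι → S → 𝔸) (ν : ι) (z : S) : 𝔸 :=
  ad (((I * η : ℂ)) • R (U ν ((T ν).symm z))⁻¹ (A ν ((T ν).symm z))) (R (U ν ((T ν).symm z))⁻¹ (A' ν ((T ν).symm z)))

/-- HIGHER-ORDER PART of the same difference: the conjugation remainder `𝓕(−iηa′_ν(z), W_ν(z))` (`conjRem`; «taking the remainder
of the expansion …», p. 405). [folklore] [cite: Balaban1985BackgroundPropagators, (3.74) p.405] -/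
def divE₂ (η : ℝ) (A A' : ι → S → 𝔸) (ν : ι) (z : S) : 𝔸 :=
  conjRem (-(((I * η : ℂ)) • R (U ν ((T ν).symm z))⁻¹ (A ν ((T ν).symm z)))) (R (U ν ((T ν).symm z))⁻¹ (A' ν ((T ν).symm z)))

/-- THE THREE-TERM FIRST-ORDER FORM of the composition «(3.70) outside ∘ (3.74) inside», direction `ν` (not displayed in print):
`−iη[A_μ(x), R(U_μ(x))(D¹*_νA′_ν)(x+e_μ)] + R(U_μ(x))·iη[a′_ν(x+e_μ), W_ν(x+e_μ)] − iη[a′_ν(x), W_ν(x)]` — the outer vertex of (3.70)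
on the transported `D¹*_νA′_ν`, and `D¹_{U,μ}` applied to the (negative) inner vertex of (3.74). [folklore]
[cite: Balaban1985BackgroundPropagators, (3.75) p.405] -/
def tBracket₂ (η : ℝ) (A A' : ι → S → 𝔸) (ν μ : ι) (x : S) : 𝔸 :=
  - ad (((I * η : ℂ)) • A μ x) (R (U μ x) (covDstar T U ν (A' ν) (T μ x)))
  + R (U μ x) (ad (((I * η : ℂ)) • R (U ν ((T ν).symm (T μ x)))⁻¹ (A ν ((T ν).symm (T μ x))))
      (R (U ν ((T ν).symm (T μ x)))⁻¹ (A' ν ((T ν).symm (T μ x)))))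
  - ad (((I * η : ℂ)) • R (U ν ((T ν).symm x))⁻¹ (A ν ((T ν).symm x))) (R (U ν ((T ν).symm x))⁻¹ (A' ν ((T ν).symm x)))

/-- THE SEVEN-TERM BRACKET of (3.75) — the summand of `(V₂(A)A′)_μ(x)` — letters verbatim, with `(D*_νA′_ν)(z)` = `covDstar T U ν (A' ν) z`,
`(D_μA′_ν)(x)` = `covD T U μ (A' ν) x`, `(D*_νA_ν)(z)` = `covDstar T U ν (A ν) z`, `(D_μA_ν)(x)` = `covD T U μ (A ν) x`,
`R(U(x, x+ηe_μ)) = R(U_μ(x))`, `R(U(x+ηe_μ, x+ηe_μ−ηe_ν))A′_ν(x+ηe_μ−ηe_ν) = R(U_ν(y)⁻¹)A′_ν(y)`, `y = (T ν)⁻¹(T μ x)`,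
`R(U(x, x−ηe_ν))A′_ν(x−ηe_ν) = R(U_ν((T ν)⁻¹x)⁻¹)A′_ν((T ν)⁻¹x)` ((3.5)):
«− iad_{A_μ(x)}R(U(x, x + ηe_μ))(D*_νA′_ν)(x + ηe_μ) + R(U(x, x + ηe_μ))iad_{A_ν(x+ηe_μ)}(D*_νA′_ν)(x + ηe_μ) − iad_{A_ν(x)}(D*_νA′_ν)(x)
+ iad_{A_ν(x)}(D_μA′_ν)(x) + iad_{(D_μA_ν)(x)}R(U(x, x + ηe_μ))A′_ν(x + ηe_μ) + R(U(x, x + ηe_μ))iad_{(D*_νA_ν)(x+ηe_μ)}·R(U(x + ηe_μ,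
x + ηe_μ − ηe_ν))A′_ν(x + ηe_μ − ηe_ν) − iad_{(D*_νA_ν)(x)}R(U(x, x − ηe_ν))A′_ν(x − ηe_ν)». [folklore]
[cite: Balaban1985BackgroundPropagators, (3.75) p.405] -/
def sBracket₂ (η : ℝ) (A A' : ι → S → 𝔸) (ν μ : ι) (x : S) : 𝔸 :=
  - ad (((I * η : ℂ)) • A μ x) (R (U μ x) (covDstar T U ν (A' ν) (T μ x)))
  + R (U μ x) (ad (((I * η : ℂ)) • A ν (T μ x)) (covDstar T U ν (A' ν) (T μ x)))
  - ad (((I * η : ℂ)) • A ν x) (covDstar T U ν (A' ν) x)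
  + ad (((I * η : ℂ)) • A ν x) (covD T U μ (A' ν) x)
  + ad (((I * η : ℂ)) • covD T U μ (A ν) x) (R (U μ x) (A' ν (T μ x)))
  + R (U μ x) (ad (((I * η : ℂ)) • covDstar T U ν (A ν) (T μ x))
      (R (U ν ((T ν).symm (T μ x)))⁻¹ (A' ν ((T ν).symm (T μ x)))))
  - ad (((I * η : ℂ)) • covDstar T U ν (A ν) x) (R (U ν ((T ν).symm x))⁻¹ (A' ν ((T ν).symm x)))

/-- THE HIGHER-ORDER TERMS of the composition, direction `ν` (`b_μ = iηA_μ(x)`, `E₁ = divE₁`, `E₂ = divE₂`):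
`D¹_{U,μ}(E₂)(x) + [b_μ, R(U_μ(x))(E₂ − E₁)(x+e_μ)] + 𝓕(b_μ, R(U_μ(x))(D¹*_{U′U,ν}A′_ν)(x+e_μ))` — every product of two or more
expansion letters (the outer remainder of (3.70), the outer vertex on the inner correction, the transported inner remainder). [folklore]
[cite: Balaban1985BackgroundPropagators, (3.75) p.405, (3.72) p.405] -/
def fRem₂ (η : ℝ) (A A' : ι → S → 𝔸) (ν μ : ι) (x : S) : 𝔸 :=
  covD T U μ (divE₂ T U η A A' ν) x
  + ad (((I * η : ℂ)) • A μ x) (R (U μ x) (divE₂ T U η A A' ν (T μ x) - divE₁ T U η A A' ν (T μ x)))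
  + conjRem (((I * η : ℂ)) • A μ x) (R (U μ x) (covDstar T (prodCfg U η A) ν (A' ν) (T μ x)))

/-- **`F_{2,k}(A)A′`** of (3.75), EXPLICITLY: `(F₂(A)A′)_μ(x) = −Σ_ν fRem₂_ν` (the print's sign: «… ] − (F_{2,k}(A)A′)_μ(x)»).
[folklore] [cite: Balaban1985BackgroundPropagators, (3.75) p.405] -/
def F₂op [Fintype ι] (η : ℝ) (A A' : ι → S → 𝔸) (μ : ι) (x : S) : 𝔸 := -∑ ν, fRem₂ T U η A A' ν μ x

/-- **`V₂(A)A′`** — THE OPERATOR DEFINED BY THE LAST EQUALITY of (3.75), «… − Σ_{ν=1}^d[ ⋯ ] − (F_{2,k}(A)A′)_μ(x) = (DD*A′)_μ(x) −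
(V₂(A)A′)_μ(x), (3.75)»: `(V₂(A)A′)_μ(x) = Σ_ν (seven-term bracket)_ν + (F_{2,k}(A)A′)_μ(x)` — first AND higher orders in `A`; here
`V₂op = Σ_ν sBracket₂_ν + F₂op` (×`η²`). [folklore] [cite: Balaban1985BackgroundPropagators, (3.75) p.405] -/
def V₂op [Fintype ι] (η : ℝ) (A A' : ι → S → 𝔸) (μ : ι) (x : S) : 𝔸 :=
  ∑ ν, sBracket₂ T U η A A' ν μ x + F₂op T U η A A' μ x

end Objects

/-! ## §3  (3.75) as kernel identities -/

section Eq375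

variable {𝔸 : Type*} [NormedRing 𝔸] [NormedAlgebra ℂ 𝔸] [CompleteSpace 𝔸] {S : Type*} {ι : Type*}
variable (T : ι → Equiv.Perm S) (U : ι → S → 𝔸ˣ)

omit [NormedAlgebra ℂ 𝔸] [CompleteSpace 𝔸] in
/-- The left side of (3.75) IS the covariant gradient of the site divergence (3.8): `D¹_μ(D¹*A′)(x) = Σ_ν D¹_μ(D¹*_νA′_ν)(x)`
(`B9Eq39Adjoint.divB`, BY NAME; additivity of `D¹_μ`). [folklore] [cite: Balaban1985BackgroundPropagators, (3.8) p.392, (3.75) p.405] -/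
theorem covD_divB_eq_gradDiv [Fintype ι] (A' : ι → S → 𝔸) (μ : ι) (x : S) :
    covD T U μ (divB T U A') x = gradDiv T U A' μ x := by
  simp only [gradDiv, covD, divB, R_sum, Finset.sum_sub_distrib]

/-- (3.74) for the letter `G = A′_ν`, split into orders: `(D¹*_{U′U,ν}A′_ν)(z) = (D¹*_{U,ν}A′_ν)(z) − E₁(z) + E₂(z)`
(`B9Eq370Expansion.covDstar_prodCfg_expand`, BY NAME). [folklore] [cite: Balaban1985BackgroundPropagators, (3.74) p.405] -/
theorem covDstar_prodCfg_split (η : ℝ) (A A' : ι → S → 𝔸) (ν : ι) (z : S) :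
    covDstar T (prodCfg U η A) ν (A' ν) z
      = covDstar T U ν (A' ν) z - divE₁ T U η A A' ν z + divE₂ T U η A A' ν z :=
  covDstar_prodCfg_expand T U η A ν (A' ν) z

/-- **(3.75), FIRST EQUALITY, PER DIRECTION**: `D¹_{U′U,μ}(D¹*_{U′U,ν}A′_ν)(x) = D¹_{U,μ}(D¹*_{U,ν}A′_ν)(x) − tBracket₂_ν(x) + fRem₂_ν(x)` —
the composition of the two expansions (3.70) (outside, `covD_prodCfg_expand`) and (3.74) (inside, `covDstar_prodCfg_expand`) with the
first-order terms collected in the three-term form and ALL higher-order terms in `fRem₂`. [folklore]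
[cite: Balaban1985BackgroundPropagators, (3.75) p.405] -/
theorem covD_covDstar_prodCfg (η : ℝ) (A A' : ι → S → 𝔸) (ν μ : ι) (x : S) :
    covD T (prodCfg U η A) μ (covDstar T (prodCfg U η A) ν (A' ν)) x
      = covD T U μ (covDstar T U ν (A' ν)) x - tBracket₂ T U η A A' ν μ x + fRem₂ T U η A A' ν μ x := by
  rw [covD_prodCfg_expand]
  simp only [covD, covDstar_prodCfg_expand, tBracket₂, fRem₂, divE₁, divE₂, R_add, R_sub, ad_add_right, ad_sub_right]
  abel

/-- **(3.75), FIRST EQUALITY**: `(D¹_{U′U}D¹*_{U′U}A′)_μ(x) = (D¹_UD¹*_UA′)_μ(x) − Σ_ν tBracket₂_ν(x) − (F₂(A)A′)_μ(x)` (×`η²`). [folklore]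
[cite: Balaban1985BackgroundPropagators, (3.75) p.405] -/
theorem gradDiv_prodCfg_eq_tBracket₂ [Fintype ι] (η : ℝ) (A A' : ι → S → 𝔸) (μ : ι) (x : S) :
    gradDiv T (prodCfg U η A) A' μ x
      = gradDiv T U A' μ x - ∑ ν, tBracket₂ T U η A A' ν μ x - F₂op T U η A A' μ x := by
  simp only [gradDiv, F₂op, covD_covDstar_prodCfg, Finset.sum_add_distrib, Finset.sum_sub_distrib, sub_neg_eq_add]

omit [CompleteSpace 𝔸] in
/-- **(3.75) — THE REGROUPING INTO THE PRINTED BRACKET**, per direction: the three-term form EQUALS the seven-term bracket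
(`R(U_μ(x))·iη[a′, W] = iη[R(U_μ(x))a′, R(U_μ(x))W]` by `R_ad`; then `a′_ν = D¹*_νA_ν + A_ν`, `W_ν = D¹*_νA′_ν + A′_ν` pointwise and
`R(U_μ(x))X(x+e_μ) = (D¹_μX)(x) + X(x)` for `X = A_ν, A′_ν`: the print's seven terms, letter for letter). [folklore]
[cite: Balaban1985BackgroundPropagators, (3.75) p.405] -/
theorem tBracket₂_eq_sBracket₂ (η : ℝ) (A A' : ι → S → 𝔸) (ν μ : ι) (x : S) :
    tBracket₂ T U η A A' ν μ x = sBracket₂ T U η A A' ν μ x := by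
  simp only [tBracket₂, sBracket₂, covDstar, covD, R_ad, R_Iη_smul, R_sub, ad_smul_left, ad_sub_left, ad_sub_right, smul_sub]
  abel

/-- **(3.75) WITH THE PRINTED BRACKET**: `(D¹_{U′U}D¹*_{U′U}A′)_μ(x) = (D¹_UD¹*_UA′)_μ(x) − Σ_ν sBracket₂_ν(x) − (F₂(A)A′)_μ(x)`
(«= (D_U D*_U A′)_μ(x) − Σ_{ν=1}^d[ ⋯ seven terms ⋯ ] − (F_{2,k}(A)A′)_μ(x)»; ×`η²`). [folklore] [cite: Balaban1985BackgroundPropagators, (3.75) p.405] -/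
theorem gradDiv_prodCfg_eq_sBracket₂ [Fintype ι] (η : ℝ) (A A' : ι → S → 𝔸) (μ : ι) (x : S) :
    gradDiv T (prodCfg U η A) A' μ x
      = gradDiv T U A' μ x - ∑ ν, sBracket₂ T U η A A' ν μ x - F₂op T U η A A' μ x := by
  simp only [gradDiv_prodCfg_eq_tBracket₂, tBracket₂_eq_sBracket₂]

/-- **(3.75)**: `(D¹_{U′U}D¹*_{U′U}A′)_μ(x) = (D¹_UD¹*_UA′)_μ(x) − (V₂(A)A′)_μ(x)` («= (DD*A′)_μ(x) − (V₂(A)A′)_μ(x), (3.75)»; ×`η²`), with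
`V₂(A)A′ = Σ_ν(seven-term bracket)_ν + F_{2,k}(A)A′` as the print defines it and `F_{2,k}` EXPLICIT (`F₂op`). [folklore]
[cite: Balaban1985BackgroundPropagators, (3.75) p.405] -/
theorem gradDiv_prodCfg [Fintype ι] (η : ℝ) (A A' : ι → S → 𝔸) (μ : ι) (x : S) :
    gradDiv T (prodCfg U η A) A' μ x = gradDiv T U A' μ x - V₂op T U η A A' μ x := by
  rw [gradDiv_prodCfg_eq_sBracket₂, V₂op, sub_sub]

/-- **(3.75), THE PRINT'S LITERAL LEFT SIDE** `D_{U′U}` applied to the site divergence `D*_{U′U}A′` of (3.8)/(3.74):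
`D¹_{U′U,μ}(D¹*_{U′U}A′)(x) = D¹_{U,μ}(D¹*_UA′)(x) − (V₂(A)A′)_μ(x)` (×`η²`). [folklore] [cite: Balaban1985BackgroundPropagators, (3.75) p.405] -/
theorem covD_divB_prodCfg [Fintype ι] (η : ℝ) (A A' : ι → S → 𝔸) (μ : ι) (x : S) :
    covD T (prodCfg U η A) μ (divB T (prodCfg U η A) A') x = covD T U μ (divB T U A') x - V₂op T U η A A' μ x := by
  rw [covD_divB_eq_gradDiv, covD_divB_eq_gradDiv, gradDiv_prodCfg]

end Eq375

/-! ## §4  «The bounds (3.72), (3.73)» for `F₂`, `V₂`, every `O(1)` explicit (uniform sup hypotheses in place of the `st(b)`-sups) -/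

section Bounds

variable {𝔸 : Type*} [NormedRing 𝔸] [NormedAlgebra ℂ 𝔸] [CompleteSpace 𝔸] {S : Type*} {ι : Type*}
variable (T : ι → Equiv.Perm S) (U : ι → S → 𝔸ˣ)

omit [CompleteSpace 𝔸] in
/-- `‖E₁(z)‖ ≤ 2sw` for transported exponent letters `‖iηR(U(b))⁻¹A(b)‖ ≤ s` and transported argument letters `‖R(U(b))⁻¹A′(b)‖ ≤ w`.
[folklore] -/
theorem norm_divE₁_le {η s w : ℝ} (hs : 0 ≤ s) (A A' : ι → S → 𝔸)
    (hbt : ∀ κ z, ‖((I * η : ℂ)) • R (U κ z)⁻¹ (A κ z)‖ ≤ s) (hW : ∀ κ z, ‖R (U κ z)⁻¹ (A' κ z)‖ ≤ w) (ν : ι) (z : S) :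
    ‖divE₁ T U η A A' ν z‖ ≤ 2 * s * w := by
  unfold divE₁
  exact (norm_ad_le_of_le (hbt ν _) _).trans (mul_le_mul_of_nonneg_left (hW ν _) (by linarith))

/-- `‖E₂(z)‖ ≤ 2s²e^{2s}w` — the one-transport remainder (`norm_conjRem_le_sq`). [folklore]
[cite: Balaban1985BackgroundPropagators, (3.72) p.405] -/
theorem norm_divE₂_le {η s w : ℝ} (A A' : ι → S → 𝔸)
    (hbt : ∀ κ z, ‖((I * η : ℂ)) • R (U κ z)⁻¹ (A κ z)‖ ≤ s) (hW : ∀ κ z, ‖R (U κ z)⁻¹ (A' κ z)‖ ≤ w) (ν : ι) (z : S) :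
    ‖divE₂ T U η A A' ν z‖ ≤ 2 * s ^ 2 * Real.exp (2 * s) * w := by
  have hb' : ‖-(((I * η : ℂ)) • R (U ν ((T ν).symm z))⁻¹ (A ν ((T ν).symm z)))‖ ≤ s := by
    rw [norm_neg]; exact hbt ν _
  unfold divE₂
  exact (norm_conjRem_le_of_le hb' _).trans (mul_le_mul_of_nonneg_left (hW ν _) (by positivity))

omit [NormedAlgebra ℂ 𝔸] [CompleteSpace 𝔸] in
/-- `‖(D¹*_νA′_ν)(z)‖ ≤ 2w` from the letter bounds. [folklore] -/
theorem norm_covDstar_le_of {w : ℝ} (A' : ι → S → 𝔸) (hW : ∀ κ z, ‖R (U κ z)⁻¹ (A' κ z)‖ ≤ w)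
    (hA' : ∀ κ z, ‖A' κ z‖ ≤ w) (ν : ι) (z : S) : ‖covDstar T U ν (A' ν) z‖ ≤ 2 * w := by
  unfold covDstar
  exact (norm_sub_le _ _).trans (by linarith [hW ν ((T ν).symm z), hA' ν z])

/-- `‖(D¹*_{U′U,ν}A′_ν)(z)‖ ≤ 2w(1 + s + s²e^{2s})`. [folklore] [cite: Balaban1985BackgroundPropagators, (3.74) p.405] -/
theorem norm_covDstar_prodCfg_le {η s w : ℝ} (hs : 0 ≤ s) (A A' : ι → S → 𝔸)
    (hbt : ∀ κ z, ‖((I * η : ℂ)) • R (U κ z)⁻¹ (A κ z)‖ ≤ s) (hW : ∀ κ z, ‖R (U κ z)⁻¹ (A' κ z)‖ ≤ w)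
    (hA' : ∀ κ z, ‖A' κ z‖ ≤ w) (ν : ι) (z : S) :
    ‖covDstar T (prodCfg U η A) ν (A' ν) z‖ ≤ 2 * w * (1 + s + s ^ 2 * Real.exp (2 * s)) := by
  rw [covDstar_prodCfg_split]
  have h1 := norm_covDstar_le_of T U A' hW hA' ν z
  have h2 := norm_divE₁_le T U hs A A' hbt hW ν z
  have h3 := norm_divE₂_le T U A A' hbt hW ν z
  calc _ ≤ 2 * w + 2 * s * w + 2 * s ^ 2 * Real.exp (2 * s) * w := norm_add_le_of_le (norm_sub_le_of_le h1 h2) h3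
    _ = 2 * w * (1 + s + s ^ 2 * Real.exp (2 * s)) := by ring

/-- **THE HIGHER-ORDER TERMS, ONE DIRECTION, ABSTRACT SIZES**: with `‖iηA(b)‖ ≤ s`, `‖iηR(U(b))⁻¹A(b)‖ ≤ s`, transport size
`‖U(b)‖, ‖U(b)⁻¹‖ ≤ ρ`, `ρ ≥ 1`, and `A′`-letters (bare and backward-transported) `≤ w`:  `‖fRem₂_ν(x)‖ ≤ 4ρ²s²e^{2s}w(3 + 2s + s²e^{2s})`
— quadratic in `s` («|(F_{2,k}(A)A′)_μ(x)| ≤ O(1)|A|²|A′|»). [folklore] [cite: Balaban1985BackgroundPropagators, (3.72) p.405] -/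
theorem norm_fRem₂_le_of {η s w ρ : ℝ} (hs : 0 ≤ s) (hw : 0 ≤ w) (hρ : 1 ≤ ρ)
    (hU : ∀ κ z, ‖(U κ z : 𝔸)‖ ≤ ρ) (hU' : ∀ κ z, ‖(((U κ z)⁻¹ : 𝔸ˣ) : 𝔸)‖ ≤ ρ) (A A' : ι → S → 𝔸)
    (hb : ∀ κ z, ‖((I * η : ℂ)) • A κ z‖ ≤ s) (hbt : ∀ κ z, ‖((I * η : ℂ)) • R (U κ z)⁻¹ (A κ z)‖ ≤ s)
    (hW : ∀ κ z, ‖R (U κ z)⁻¹ (A' κ z)‖ ≤ w) (hA' : ∀ κ z, ‖A' κ z‖ ≤ w) (ν μ : ι) (x : S) :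
    ‖fRem₂ T U η A A' ν μ x‖
      ≤ 4 * ρ ^ 2 * s ^ 2 * Real.exp (2 * s) * w * (3 + 2 * s + s ^ 2 * Real.exp (2 * s)) := by
  have hE1 : 1 ≤ Real.exp (2 * s) := Real.one_le_exp (by linarith)
  have hρ2 : 1 ≤ ρ ^ 2 := one_le_pow₀ hρ
  have hR : ∀ Z : 𝔸, ‖R (U μ x) Z‖ ≤ ρ ^ 2 * ‖Z‖ := fun Z => norm_R_le_sq _ (hU μ x) (hU' μ x) Z
  have hE1p := norm_divE₁_le T U hs A A' hbt hW ν (T μ x)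
  have hE2p := norm_divE₂_le T U A A' hbt hW ν (T μ x)
  have hE2x := norm_divE₂_le T U A A' hbt hW ν x
  have hC := norm_covDstar_prodCfg_le T U hs A A' hbt hW hA' ν (T μ x)
  have P1 : ‖covD T U μ (divE₂ T U η A A' ν) x‖ ≤ 4 * ρ ^ 2 * s ^ 2 * Real.exp (2 * s) * w := by
    have h1 : ‖R (U μ x) (divE₂ T U η A A' ν (T μ x))‖ ≤ ρ ^ 2 * (2 * s ^ 2 * Real.exp (2 * s) * w) :=
      (hR _).trans (mul_le_mul_of_nonneg_left hE2p (by positivity))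
    have h2 : ‖divE₂ T U η A A' ν x‖ ≤ ρ ^ 2 * (2 * s ^ 2 * Real.exp (2 * s) * w) :=
      hE2x.trans (le_mul_of_one_le_left (by positivity) hρ2)
    unfold covD
    exact (norm_sub_le_of_le h1 h2).trans (le_of_eq (by ring))
  have P2 : ‖ad (((I * η : ℂ)) • A μ x) (R (U μ x) (divE₂ T U η A A' ν (T μ x) - divE₁ T U η A A' ν (T μ x)))‖
      ≤ 4 * ρ ^ 2 * s ^ 2 * w * (s * Real.exp (2 * s) + 1) := by
    have h1 : ‖R (U μ x) (divE₂ T U η A A' ν (T μ x) - divE₁ T U η A A' ν (T μ x))‖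
        ≤ ρ ^ 2 * (2 * s ^ 2 * Real.exp (2 * s) * w + 2 * s * w) :=
      (hR _).trans (mul_le_mul_of_nonneg_left (norm_sub_le_of_le hE2p hE1p) (by positivity))
    calc _ ≤ 2 * s * ‖R (U μ x) (divE₂ T U η A A' ν (T μ x) - divE₁ T U η A A' ν (T μ x))‖ :=
          norm_ad_le_of_le (hb μ x) _
      _ ≤ 2 * s * (ρ ^ 2 * (2 * s ^ 2 * Real.exp (2 * s) * w + 2 * s * w)) :=
          mul_le_mul_of_nonneg_left h1 (by linarith)
      _ = 4 * ρ ^ 2 * s ^ 2 * w * (s * Real.exp (2 * s) + 1) := by ring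
  have P3 : ‖conjRem (((I * η : ℂ)) • A μ x) (R (U μ x) (covDstar T (prodCfg U η A) ν (A' ν) (T μ x)))‖
      ≤ 4 * ρ ^ 2 * s ^ 2 * Real.exp (2 * s) * w * (1 + s + s ^ 2 * Real.exp (2 * s)) := by
    have h1 : ‖R (U μ x) (covDstar T (prodCfg U η A) ν (A' ν) (T μ x))‖
        ≤ ρ ^ 2 * (2 * w * (1 + s + s ^ 2 * Real.exp (2 * s))) :=
      (hR _).trans (mul_le_mul_of_nonneg_left hC (by positivity))
    calc _ ≤ 2 * s ^ 2 * Real.exp (2 * s) * ‖R (U μ x) (covDstar T (prodCfg U η A) ν (A' ν) (T μ x))‖ :=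
          norm_conjRem_le_of_le (hb μ x) _
      _ ≤ 2 * s ^ 2 * Real.exp (2 * s) * (ρ ^ 2 * (2 * w * (1 + s + s ^ 2 * Real.exp (2 * s)))) :=
          mul_le_mul_of_nonneg_left h1 (by positivity)
      _ = 4 * ρ ^ 2 * s ^ 2 * Real.exp (2 * s) * w * (1 + s + s ^ 2 * Real.exp (2 * s)) := by ring
  have hsum : ‖fRem₂ T U η A A' ν μ x‖
      ≤ 4 * ρ ^ 2 * s ^ 2 * Real.exp (2 * s) * w + 4 * ρ ^ 2 * s ^ 2 * w * (s * Real.exp (2 * s) + 1)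
        + 4 * ρ ^ 2 * s ^ 2 * Real.exp (2 * s) * w * (1 + s + s ^ 2 * Real.exp (2 * s)) := by
    unfold fRem₂
    exact norm_add_le_of_le (norm_add_le_of_le P1 P2) P3
  have hgap : 0 ≤ 4 * ρ ^ 2 * s ^ 2 * w * (Real.exp (2 * s) - 1) :=
    mul_nonneg (by positivity) (sub_nonneg.mpr hE1)
  have key : 4 * ρ ^ 2 * s ^ 2 * Real.exp (2 * s) * w + 4 * ρ ^ 2 * s ^ 2 * w * (s * Real.exp (2 * s) + 1)
        + 4 * ρ ^ 2 * s ^ 2 * Real.exp (2 * s) * w * (1 + s + s ^ 2 * Real.exp (2 * s))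
        + 4 * ρ ^ 2 * s ^ 2 * w * (Real.exp (2 * s) - 1)
      = 4 * ρ ^ 2 * s ^ 2 * Real.exp (2 * s) * w * (3 + 2 * s + s ^ 2 * Real.exp (2 * s)) := by ring
  linarith

/-- **(3.72) FOR `F₂`, FIRST INEQUALITY** — `|(F_{2,k}(A)A′)_μ(x)| ≤ O(1)|A|²|A′|` — on the carrier, one direction, with the uniform sups
`‖A(b)‖ ≤ a`, `‖A′(b)‖ ≤ a′` (in place of the sups over `st(b)`) and transport size `ρ ≥ 1` (`‖U(b)‖, ‖U(b)⁻¹‖ ≤ ρ`; `ρ = 1` for a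
`G`-valued background in an operator norm):  `‖fRem₂_ν(x)‖ ≤ 4ρ⁴s²e^{2s}(3 + 2s + s²e^{2s})·a′`, `s = ηρ²a` — `O(1) = 4ρ⁸e^{2s}(3 + 2s +
s²e^{2s})` times `(ηa)²a′` (the `η²` is the normalisation `D¹ = ηD`, twice). [folklore] [cite: Balaban1985BackgroundPropagators, (3.72) p.405] -/
theorem norm_fRem₂_le {η ρ a a' : ℝ} (hη : 0 ≤ η) (hρ : 1 ≤ ρ)
    (hU : ∀ κ z, ‖(U κ z : 𝔸)‖ ≤ ρ) (hU' : ∀ κ z, ‖(((U κ z)⁻¹ : 𝔸ˣ) : 𝔸)‖ ≤ ρ)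
    (A A' : ι → S → 𝔸) (hA : ∀ κ z, ‖A κ z‖ ≤ a) (hA' : ∀ κ z, ‖A' κ z‖ ≤ a') (ν μ : ι) (x : S) :
    ‖fRem₂ T U η A A' ν μ x‖
      ≤ 4 * ρ ^ 4 * (η * ρ ^ 2 * a) ^ 2 * Real.exp (2 * (η * ρ ^ 2 * a))
          * (3 + 2 * (η * ρ ^ 2 * a) + (η * ρ ^ 2 * a) ^ 2 * Real.exp (2 * (η * ρ ^ 2 * a))) * a' := by
  have ha : 0 ≤ a := (norm_nonneg _).trans (hA ν x)
  have ha' : 0 ≤ a' := (norm_nonneg _).trans (hA' ν x)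
  have hρ0 : 0 ≤ ρ := zero_le_one.trans hρ
  have hρ2 : 1 ≤ ρ ^ 2 := one_le_pow₀ hρ
  have hs : 0 ≤ η * ρ ^ 2 * a := by positivity
  have hw : 0 ≤ ρ ^ 2 * a' := by positivity
  have hb : ∀ κ z, ‖((I * η : ℂ)) • A κ z‖ ≤ η * ρ ^ 2 * a := fun κ z => by
    rw [norm_Iη_smul hη]
    calc η * ‖A κ z‖ ≤ η * a := mul_le_mul_of_nonneg_left (hA κ z) hη
      _ ≤ η * (ρ ^ 2 * a) := mul_le_mul_of_nonneg_left (le_mul_of_one_le_left ha hρ2) hη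
      _ = η * ρ ^ 2 * a := by ring
  have hbt : ∀ κ z, ‖((I * η : ℂ)) • R (U κ z)⁻¹ (A κ z)‖ ≤ η * ρ ^ 2 * a := fun κ z => by
    rw [norm_Iη_smul hη]
    have h := norm_R_le_sq (U κ z)⁻¹ (hU' κ z) (by rw [inv_inv]; exact hU κ z) (A κ z)
    calc η * ‖R (U κ z)⁻¹ (A κ z)‖ ≤ η * (ρ ^ 2 * a) :=
          mul_le_mul_of_nonneg_left (h.trans (mul_le_mul_of_nonneg_left (hA κ z) (by positivity))) hη
      _ = η * ρ ^ 2 * a := by ring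
  have hW : ∀ κ z, ‖R (U κ z)⁻¹ (A' κ z)‖ ≤ ρ ^ 2 * a' := fun κ z =>
    (norm_R_le_sq (U κ z)⁻¹ (hU' κ z) (by rw [inv_inv]; exact hU κ z) _).trans
      (mul_le_mul_of_nonneg_left (hA' κ z) (by positivity))
  have hA'w : ∀ κ z, ‖A' κ z‖ ≤ ρ ^ 2 * a' := fun κ z => (hA' κ z).trans (le_mul_of_one_le_left ha' hρ2)
  calc _ ≤ _ := norm_fRem₂_le_of T U hs hw hρ hU hU' A A' hb hbt hW hA'w ν μ x
    _ = _ := by ring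

/-- **(3.72) FOR `F₂(A)A′ = −Σ_ν fRem₂_ν`**: `‖(F₂(A)A′)_μ(x)‖ ≤ d·4ρ⁴s²e^{2s}(3 + 2s + s²e^{2s})·a′`, `d = |ι|`, `s = ηρ²a`. [folklore]
[cite: Balaban1985BackgroundPropagators, (3.72) p.405, (3.75) p.405] -/
theorem norm_F₂op_le [Fintype ι] {η ρ a a' : ℝ} (hη : 0 ≤ η) (hρ : 1 ≤ ρ)
    (hU : ∀ κ z, ‖(U κ z : 𝔸)‖ ≤ ρ) (hU' : ∀ κ z, ‖(((U κ z)⁻¹ : 𝔸ˣ) : 𝔸)‖ ≤ ρ)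
    (A A' : ι → S → 𝔸) (hA : ∀ κ z, ‖A κ z‖ ≤ a) (hA' : ∀ κ z, ‖A' κ z‖ ≤ a') (μ : ι) (x : S) :
    ‖F₂op T U η A A' μ x‖
      ≤ Fintype.card ι * (4 * ρ ^ 4 * (η * ρ ^ 2 * a) ^ 2 * Real.exp (2 * (η * ρ ^ 2 * a))
          * (3 + 2 * (η * ρ ^ 2 * a) + (η * ρ ^ 2 * a) ^ 2 * Real.exp (2 * (η * ρ ^ 2 * a))) * a') := by
  unfold F₂op
  rw [norm_neg]
  calc _ ≤ ∑ ν, ‖fRem₂ T U η A A' ν μ x‖ := norm_sum_le _ _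
    _ ≤ ∑ _ν : ι, 4 * ρ ^ 4 * (η * ρ ^ 2 * a) ^ 2 * Real.exp (2 * (η * ρ ^ 2 * a))
          * (3 + 2 * (η * ρ ^ 2 * a) + (η * ρ ^ 2 * a) ^ 2 * Real.exp (2 * (η * ρ ^ 2 * a))) * a' :=
        Finset.sum_le_sum fun ν _ => norm_fRem₂_le T U hη hρ hU hU' A A' hA hA' ν μ x
    _ = _ := by simp [Finset.sum_const, Finset.card_univ, nsmul_eq_mul]

/-- **(3.72) FOR `F₂`, SECOND INEQUALITY, AT THE PRINTED SCALE** (unitary-size background `ρ = 1`; (3.37) at the letters: `‖A(b)‖ ≤ a ≤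
α₁(L^jη)⁻¹`, `L ≥ 1`, `η > 0`, so `s = ηa ≤ α₁L^{−j} ≤ α₁`):  `‖(F₂(A)A′)_μ(x)‖ ≤ d·4e^{2α₁}(3 + 2α₁ + α₁²e^{2α₁})·α₁²·L^{−2j}·a′` — i.e. `η²`
times the print's `O(1)α₁²(L^jη)⁻²|A′|` with `O(1) = 4d·e^{2α₁}(3 + 2α₁ + α₁²e^{2α₁})` («an absolute constant depending on d only» once
`α₁ ≤ 1`). [folklore] [cite: Balaban1985BackgroundPropagators, (3.72) p.405, (3.37) p.396] -/
theorem norm_F₂op_le_printed [Fintype ι] {η L α₁ a a' : ℝ} {j : ℕ} (hη : 0 < η) (hL : 1 ≤ L)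
    (hU : ∀ κ z, ‖(U κ z : 𝔸)‖ ≤ 1) (hU' : ∀ κ z, ‖(((U κ z)⁻¹ : 𝔸ˣ) : 𝔸)‖ ≤ 1)
    (A A' : ι → S → 𝔸) (hA : ∀ κ z, ‖A κ z‖ ≤ a) (ha : a ≤ α₁ * (L ^ j * η)⁻¹) (hA' : ∀ κ z, ‖A' κ z‖ ≤ a')
    (μ : ι) (x : S) :
    ‖F₂op T U η A A' μ x‖
      ≤ Fintype.card ι * (4 * Real.exp (2 * α₁) * (3 + 2 * α₁ + α₁ ^ 2 * Real.exp (2 * α₁))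
          * α₁ ^ 2 * ((L ^ j)⁻¹) ^ 2 * a') := by
  have h := norm_F₂op_le T U hη.le le_rfl hU hU' A A' hA hA' μ x
  have hLj : 1 ≤ L ^ j := one_le_pow₀ hL
  have hLj0 : 0 < L ^ j := lt_of_lt_of_le one_pos hLj
  have ha0 : 0 ≤ a := (norm_nonneg _).trans (hA μ x)
  have ha'0 : 0 ≤ a' := (norm_nonneg _).trans (hA' μ x)
  have hs : η * 1 ^ 2 * a ≤ α₁ * (L ^ j)⁻¹ := by
    calc η * 1 ^ 2 * a = η * a := by ring
      _ ≤ η * (α₁ * (L ^ j * η)⁻¹) := mul_le_mul_of_nonneg_left ha hη.le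
      _ = α₁ * (L ^ j)⁻¹ := by field_simp
  have hs0 : 0 ≤ η * 1 ^ 2 * a := by positivity
  have hα : 0 ≤ α₁ := by
    by_contra hc
    have h1 : α₁ * (L ^ j)⁻¹ < 0 := mul_neg_of_neg_of_pos (lt_of_not_ge hc) (inv_pos.mpr hLj0)
    linarith
  have hs1 : η * 1 ^ 2 * a ≤ α₁ := hs.trans (mul_le_of_le_one_right hα (inv_le_one_of_one_le₀ hLj))
  have hE : Real.exp (2 * (η * 1 ^ 2 * a)) ≤ Real.exp (2 * α₁) := Real.exp_le_exp.mpr (by linarith)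
  have hsq : (η * 1 ^ 2 * a) ^ 2 ≤ α₁ ^ 2 * ((L ^ j)⁻¹) ^ 2 := by
    rw [← mul_pow]; exact pow_le_pow_left₀ hs0 hs 2
  have hsq' : (η * 1 ^ 2 * a) ^ 2 ≤ α₁ ^ 2 := pow_le_pow_left₀ hs0 hs1 2
  have hP : 3 + 2 * (η * 1 ^ 2 * a) + (η * 1 ^ 2 * a) ^ 2 * Real.exp (2 * (η * 1 ^ 2 * a))
      ≤ 3 + 2 * α₁ + α₁ ^ 2 * Real.exp (2 * α₁) := by
    have := mul_le_mul hsq' hE (by positivity) (sq_nonneg α₁)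
    linarith
  refine h.trans (mul_le_mul_of_nonneg_left ?_ (Nat.cast_nonneg _))
  calc 4 * (1 : ℝ) ^ 4 * (η * 1 ^ 2 * a) ^ 2 * Real.exp (2 * (η * 1 ^ 2 * a))
          * (3 + 2 * (η * 1 ^ 2 * a) + (η * 1 ^ 2 * a) ^ 2 * Real.exp (2 * (η * 1 ^ 2 * a))) * a'
      ≤ 4 * (1 : ℝ) ^ 4 * (α₁ ^ 2 * ((L ^ j)⁻¹) ^ 2) * Real.exp (2 * α₁)
          * (3 + 2 * α₁ + α₁ ^ 2 * Real.exp (2 * α₁)) * a' := by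
        gcongr
    _ = _ := by ring

omit [CompleteSpace 𝔸] in
/-- **(3.73) FOR `V₂`, FIRST INEQUALITY** — `|(V₂(A)A′)(b)| ≤ O(1)(|A||∇A′| + |∇A||A′| + |A|²|A′|)` — one direction, with uniform sups of the
letters and of the FORWARD covariant differences ((3.39): «|∇A| = max_{μ,ν} sup_x |(D_μA_ν)(x)|»; `D¹*_ν = −R∘D¹_ν∘shift`,
`B9Eq371Composition.covDstar_eq_neg_R_covD`): `‖sBracket₂_ν(x)‖ ≤ η((4ρ⁴ + 2ρ² + 2)·a·g′ + 2ρ²(1 + ρ² + ρ⁴)·g·a′)` — no `|A|²|A′|` term is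
needed for the first-order part. [folklore] [cite: Balaban1985BackgroundPropagators, (3.73) p.405, (3.39) p.397] -/
theorem norm_sBracket₂_le {η ρ a a' g g' : ℝ} (hη : 0 ≤ η)
    (hU : ∀ κ z, ‖(U κ z : 𝔸)‖ ≤ ρ) (hU' : ∀ κ z, ‖(((U κ z)⁻¹ : 𝔸ˣ) : 𝔸)‖ ≤ ρ)
    (A A' : ι → S → 𝔸) (hA : ∀ κ z, ‖A κ z‖ ≤ a) (hA' : ∀ κ z, ‖A' κ z‖ ≤ a')
    (hdA : ∀ κ τ z, ‖covD T U κ (A τ) z‖ ≤ g) (hdA' : ∀ κ τ z, ‖covD T U κ (A' τ) z‖ ≤ g') (ν μ : ι) (x : S) :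
    ‖sBracket₂ T U η A A' ν μ x‖
      ≤ η * ((4 * ρ ^ 4 + 2 * ρ ^ 2 + 2) * a * g' + 2 * ρ ^ 2 * (1 + ρ ^ 2 + ρ ^ 4) * g * a') := by
  have ha : 0 ≤ a := (norm_nonneg _).trans (hA ν x)
  have ha' : 0 ≤ a' := (norm_nonneg _).trans (hA' ν x)
  have hg : 0 ≤ g := (norm_nonneg _).trans (hdA ν ν x)
  have hg' : 0 ≤ g' := (norm_nonneg _).trans (hdA' ν ν x)
  have hρ0 : 0 ≤ ρ := (norm_nonneg _).trans (hU ν x)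
  have hR : ∀ κ z (Z : 𝔸), ‖R (U κ z) Z‖ ≤ ρ ^ 2 * ‖Z‖ := fun κ z Z => norm_R_le_sq _ (hU κ z) (hU' κ z) Z
  have hRt : ∀ κ z (Z : 𝔸), ‖R (U κ z)⁻¹ Z‖ ≤ ρ ^ 2 * ‖Z‖ := fun κ z Z =>
    norm_R_le_sq _ (hU' κ z) (by rw [inv_inv]; exact hU κ z) Z
  have hb : ∀ κ z, ‖((I * η : ℂ)) • A κ z‖ ≤ η * a := fun κ z => by
    rw [norm_Iη_smul hη]; exact mul_le_mul_of_nonneg_left (hA κ z) hη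
  have hds : ∀ κ τ z, ‖covDstar T U κ (A τ) z‖ ≤ ρ ^ 2 * g := fun κ τ z => by
    rw [covDstar_eq_neg_R_covD, norm_neg]
    exact (hRt κ _ _).trans (mul_le_mul_of_nonneg_left (hdA κ τ _) (by positivity))
  have hds' : ∀ κ τ z, ‖covDstar T U κ (A' τ) z‖ ≤ ρ ^ 2 * g' := fun κ τ z => by
    rw [covDstar_eq_neg_R_covD, norm_neg]
    exact (hRt κ _ _).trans (mul_le_mul_of_nonneg_left (hdA' κ τ _) (by positivity))
  have hbd : ∀ κ τ z, ‖((I * η : ℂ)) • covDstar T U κ (A τ) z‖ ≤ η * (ρ ^ 2 * g) := fun κ τ z => by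
    rw [norm_Iη_smul hη]; exact mul_le_mul_of_nonneg_left (hds κ τ z) hη
  have hbD : ∀ κ τ z, ‖((I * η : ℂ)) • covD T U κ (A τ) z‖ ≤ η * g := fun κ τ z => by
    rw [norm_Iη_smul hη]; exact mul_le_mul_of_nonneg_left (hdA κ τ z) hη
  -- the seven terms
  have h1 : ‖-ad (((I * η : ℂ)) • A μ x) (R (U μ x) (covDstar T U ν (A' ν) (T μ x)))‖
      ≤ 2 * (η * a) * (ρ ^ 2 * (ρ ^ 2 * g')) := by
    rw [norm_neg]
    exact (norm_ad_le_of_le (hb μ x) _).trans (mul_le_mul_of_nonneg_left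
      ((hR μ x _).trans (mul_le_mul_of_nonneg_left (hds' ν ν _) (by positivity))) (by positivity))
  have h2 : ‖R (U μ x) (ad (((I * η : ℂ)) • A ν (T μ x)) (covDstar T U ν (A' ν) (T μ x)))‖
      ≤ ρ ^ 2 * (2 * (η * a) * (ρ ^ 2 * g')) :=
    (hR μ x _).trans (mul_le_mul_of_nonneg_left
      ((norm_ad_le_of_le (hb ν _) _).trans (mul_le_mul_of_nonneg_left (hds' ν ν _) (by positivity))) (by positivity))
  have h3 : ‖ad (((I * η : ℂ)) • A ν x) (covDstar T U ν (A' ν) x)‖ ≤ 2 * (η * a) * (ρ ^ 2 * g') :=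
    (norm_ad_le_of_le (hb ν x) _).trans (mul_le_mul_of_nonneg_left (hds' ν ν x) (by positivity))
  have h4 : ‖ad (((I * η : ℂ)) • A ν x) (covD T U μ (A' ν) x)‖ ≤ 2 * (η * a) * g' :=
    (norm_ad_le_of_le (hb ν x) _).trans (mul_le_mul_of_nonneg_left (hdA' μ ν x) (by positivity))
  have h5 : ‖ad (((I * η : ℂ)) • covD T U μ (A ν) x) (R (U μ x) (A' ν (T μ x)))‖ ≤ 2 * (η * g) * (ρ ^ 2 * a') :=
    (norm_ad_le_of_le (hbD μ ν x) _).trans (mul_le_mul_of_nonneg_left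
      ((hR μ x _).trans (mul_le_mul_of_nonneg_left (hA' ν _) (by positivity))) (by positivity))
  have h6 : ‖R (U μ x) (ad (((I * η : ℂ)) • covDstar T U ν (A ν) (T μ x))
        (R (U ν ((T ν).symm (T μ x)))⁻¹ (A' ν ((T ν).symm (T μ x)))))‖
      ≤ ρ ^ 2 * (2 * (η * (ρ ^ 2 * g)) * (ρ ^ 2 * a')) :=
    (hR μ x _).trans (mul_le_mul_of_nonneg_left
      ((norm_ad_le_of_le (hbd ν ν _) _).trans (mul_le_mul_of_nonneg_left
        ((hRt ν _ _).trans (mul_le_mul_of_nonneg_left (hA' ν _) (by positivity))) (by positivity))) (by positivity))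
  have h7 : ‖ad (((I * η : ℂ)) • covDstar T U ν (A ν) x) (R (U ν ((T ν).symm x))⁻¹ (A' ν ((T ν).symm x)))‖
      ≤ 2 * (η * (ρ ^ 2 * g)) * (ρ ^ 2 * a') :=
    (norm_ad_le_of_le (hbd ν ν x) _).trans (mul_le_mul_of_nonneg_left
      ((hRt ν _ _).trans (mul_le_mul_of_nonneg_left (hA' ν _) (by positivity))) (by positivity))
  unfold sBracket₂
  refine (norm_sub_le_of_le (norm_add_le_of_le (norm_add_le_of_le (norm_add_le_of_le (norm_sub_le_of_le
    (norm_add_le_of_le h1 h2) h3) h4) h5) h6) h7).trans (le_of_eq ?_)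
  ring

omit [CompleteSpace 𝔸] in
/-- (3.73) FOR THE FIRST-ORDER PART `Σ_ν sBracket₂_ν`: `≤ d·η((4ρ⁴ + 2ρ² + 2)ag′ + 2ρ²(1 + ρ² + ρ⁴)ga′)` (= `dη(8ag′ + 6ga′)` at `ρ = 1`:
`η²·O(1)(|A||∇A′| + |∇A||A′|)` with `g = η|∇A|`, `g′ = η|∇A′|`). [folklore] [cite: Balaban1985BackgroundPropagators, (3.73) p.405] -/
theorem norm_sum_sBracket₂_le [Fintype ι] {η ρ a a' g g' : ℝ} (hη : 0 ≤ η)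
    (hU : ∀ κ z, ‖(U κ z : 𝔸)‖ ≤ ρ) (hU' : ∀ κ z, ‖(((U κ z)⁻¹ : 𝔸ˣ) : 𝔸)‖ ≤ ρ)
    (A A' : ι → S → 𝔸) (hA : ∀ κ z, ‖A κ z‖ ≤ a) (hA' : ∀ κ z, ‖A' κ z‖ ≤ a')
    (hdA : ∀ κ τ z, ‖covD T U κ (A τ) z‖ ≤ g) (hdA' : ∀ κ τ z, ‖covD T U κ (A' τ) z‖ ≤ g') (μ : ι) (x : S) :
    ‖∑ ν, sBracket₂ T U η A A' ν μ x‖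
      ≤ Fintype.card ι * (η * ((4 * ρ ^ 4 + 2 * ρ ^ 2 + 2) * a * g' + 2 * ρ ^ 2 * (1 + ρ ^ 2 + ρ ^ 4) * g * a')) := by
  calc _ ≤ ∑ ν, ‖sBracket₂ T U η A A' ν μ x‖ := norm_sum_le _ _
    _ ≤ ∑ _ν : ι, η * ((4 * ρ ^ 4 + 2 * ρ ^ 2 + 2) * a * g' + 2 * ρ ^ 2 * (1 + ρ ^ 2 + ρ ^ 4) * g * a') :=
        Finset.sum_le_sum fun ν _ => norm_sBracket₂_le T U hη hU hU' A A' hA hA' hdA hdA' ν μ x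
    _ = _ := by simp [Finset.sum_const, Finset.card_univ, nsmul_eq_mul]

/-- **(3.73) FOR `V₂`, FIRST INEQUALITY** — «|(V₁(A)A′)(b)| ≤ O(1)(|A||∇A′| + |∇A||A′| + |A|²|A′|)» transferred to `V₂` («satisfy the
bounds (3.72), (3.73)») — for the print's `V₂(A)A′ = Σ_ν(seven-term bracket)_ν + F_{2,k}(A)A′`, one direction `μ`, uniform sups (`‖A‖ ≤ a`,
`‖A′‖ ≤ a′`, `‖D¹A‖ ≤ g`, `‖D¹A′‖ ≤ g′`), transport size `ρ ≥ 1`: `‖(V₂(A)A′)_μ(x)‖ ≤ d·[η((4ρ⁴ + 2ρ² + 2)ag′ + 2ρ²(1 + ρ² + ρ⁴)ga′) +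
4ρ⁴s²e^{2s}(3 + 2s + s²e^{2s})a′]`, `s = ηρ²a` — the three printed terms with `O(1)` explicit (×`η²`). [folklore]
[cite: Balaban1985BackgroundPropagators, (3.73) p.405, (3.75) p.405] -/
theorem norm_V₂op_le [Fintype ι] {η ρ a a' g g' : ℝ} (hη : 0 ≤ η) (hρ : 1 ≤ ρ)
    (hU : ∀ κ z, ‖(U κ z : 𝔸)‖ ≤ ρ) (hU' : ∀ κ z, ‖(((U κ z)⁻¹ : 𝔸ˣ) : 𝔸)‖ ≤ ρ)
    (A A' : ι → S → 𝔸) (hA : ∀ κ z, ‖A κ z‖ ≤ a) (hA' : ∀ κ z, ‖A' κ z‖ ≤ a')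
    (hdA : ∀ κ τ z, ‖covD T U κ (A τ) z‖ ≤ g) (hdA' : ∀ κ τ z, ‖covD T U κ (A' τ) z‖ ≤ g') (μ : ι) (x : S) :
    ‖V₂op T U η A A' μ x‖
      ≤ Fintype.card ι * (η * ((4 * ρ ^ 4 + 2 * ρ ^ 2 + 2) * a * g' + 2 * ρ ^ 2 * (1 + ρ ^ 2 + ρ ^ 4) * g * a')
          + 4 * ρ ^ 4 * (η * ρ ^ 2 * a) ^ 2 * Real.exp (2 * (η * ρ ^ 2 * a))
            * (3 + 2 * (η * ρ ^ 2 * a) + (η * ρ ^ 2 * a) ^ 2 * Real.exp (2 * (η * ρ ^ 2 * a))) * a') := by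
  unfold V₂op
  have h1 := norm_sum_sBracket₂_le T U hη hU hU' A A' hA hA' hdA hdA' μ x
  have h2 := norm_F₂op_le T U hη hρ hU hU' A A' hA hA' μ x
  exact (norm_add_le_of_le h1 h2).trans (le_of_eq (by ring))

omit [CompleteSpace 𝔸] in
/-- (3.73) FOR `V₂`, SECOND INEQUALITY, FIRST-ORDER PART, AT THE PRINTED SCALE (`ρ = 1`; (3.37) at the letters: `a ≤ α₁(L^jη)⁻¹` and, for the
exponent field's covariant differences, `g ≤ η·α₁(L^jη)⁻²` = the print's `|∇^η_UA| < α₁(L^jη)⁻²` times the normalisation `D¹ = ηD`):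
`‖Σ_ν sBracket₂_ν‖ ≤ 2d·α₁·(4L^{−j}·g′ + 3L^{−2j}·a′)`. [folklore] [cite: Balaban1985BackgroundPropagators, (3.73) p.405, (3.37) p.396] -/
theorem norm_sum_sBracket₂_le_printed [Fintype ι] {η L α₁ a a' g g' : ℝ} {j : ℕ} (hη : 0 < η) (hL : 1 ≤ L)
    (hU : ∀ κ z, ‖(U κ z : 𝔸)‖ ≤ 1) (hU' : ∀ κ z, ‖(((U κ z)⁻¹ : 𝔸ˣ) : 𝔸)‖ ≤ 1)
    (A A' : ι → S → 𝔸) (hA : ∀ κ z, ‖A κ z‖ ≤ a) (ha : a ≤ α₁ * (L ^ j * η)⁻¹) (hA' : ∀ κ z, ‖A' κ z‖ ≤ a')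
    (hdA : ∀ κ τ z, ‖covD T U κ (A τ) z‖ ≤ g) (hg : g ≤ η * (α₁ * ((L ^ j * η)⁻¹) ^ 2))
    (hdA' : ∀ κ τ z, ‖covD T U κ (A' τ) z‖ ≤ g') (μ : ι) (x : S) :
    ‖∑ ν, sBracket₂ T U η A A' ν μ x‖ ≤ Fintype.card ι * (2 * α₁ * (4 * (L ^ j)⁻¹ * g' + 3 * ((L ^ j)⁻¹) ^ 2 * a')) := by
  have h := norm_sum_sBracket₂_le T U hη.le hU hU' A A' hA hA' hdA hdA' μ x
  have hLj : 1 ≤ L ^ j := one_le_pow₀ hL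
  have hLj0 : 0 < L ^ j := lt_of_lt_of_le one_pos hLj
  have ha'0 : 0 ≤ a' := (norm_nonneg _).trans (hA' μ x)
  have hg' : 0 ≤ g' := (norm_nonneg _).trans (hdA' μ μ x)
  have h1 : η * a * g' ≤ α₁ * (L ^ j)⁻¹ * g' := by
    have : η * a ≤ α₁ * (L ^ j)⁻¹ := by
      calc η * a ≤ η * (α₁ * (L ^ j * η)⁻¹) := mul_le_mul_of_nonneg_left ha hη.le
        _ = α₁ * (L ^ j)⁻¹ := by field_simp
    exact mul_le_mul_of_nonneg_right this hg'
  have h2 : η * g * a' ≤ α₁ * ((L ^ j)⁻¹) ^ 2 * a' := by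
    have : η * g ≤ α₁ * ((L ^ j)⁻¹) ^ 2 := by
      calc η * g ≤ η * (η * (α₁ * ((L ^ j * η)⁻¹) ^ 2)) := mul_le_mul_of_nonneg_left hg hη.le
        _ = α₁ * ((L ^ j)⁻¹) ^ 2 := by field_simp
    exact mul_le_mul_of_nonneg_right this ha'0
  refine h.trans (mul_le_mul_of_nonneg_left ?_ (Nat.cast_nonneg _))
  nlinarith [h1, h2]

/-- **(3.73) FOR `V₂`, SECOND INEQUALITY, AT THE PRINTED SCALE** — «≤ O(1)α₁((L^jη)⁻¹|∇A′| + (L^jη)⁻²|A′|), b ∈ Ω_j» — for the print's `V₂`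
(first-order part + `F_{2,k}`), `ρ = 1`, (3.37) at the letters (`a ≤ α₁(L^jη)⁻¹`, `g ≤ η·α₁(L^jη)⁻²`, `L ≥ 1`, `η > 0`):
`‖(V₂(A)A′)_μ(x)‖ ≤ d·α₁·[8·L^{−j}·g′ + (6 + 4α₁e^{2α₁}(3 + 2α₁ + α₁²e^{2α₁}))·L^{−2j}·a′]` — `η²` times the printed right side with `O(1)`
explicit (`g′ = η|∇A′|`; «an absolute constant depending on d only» once `α₁ ≤ 1`). [folklore]
[cite: Balaban1985BackgroundPropagators, (3.73) p.405, (3.75) p.405, (3.37) p.396] -/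
theorem norm_V₂op_le_printed [Fintype ι] {η L α₁ a a' g g' : ℝ} {j : ℕ} (hη : 0 < η) (hL : 1 ≤ L)
    (hU : ∀ κ z, ‖(U κ z : 𝔸)‖ ≤ 1) (hU' : ∀ κ z, ‖(((U κ z)⁻¹ : 𝔸ˣ) : 𝔸)‖ ≤ 1)
    (A A' : ι → S → 𝔸) (hA : ∀ κ z, ‖A κ z‖ ≤ a) (ha : a ≤ α₁ * (L ^ j * η)⁻¹) (hA' : ∀ κ z, ‖A' κ z‖ ≤ a')
    (hdA : ∀ κ τ z, ‖covD T U κ (A τ) z‖ ≤ g) (hg : g ≤ η * (α₁ * ((L ^ j * η)⁻¹) ^ 2))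
    (hdA' : ∀ κ τ z, ‖covD T U κ (A' τ) z‖ ≤ g') (μ : ι) (x : S) :
    ‖V₂op T U η A A' μ x‖
      ≤ Fintype.card ι * (α₁ * (8 * (L ^ j)⁻¹ * g'
          + (6 + 4 * α₁ * Real.exp (2 * α₁) * (3 + 2 * α₁ + α₁ ^ 2 * Real.exp (2 * α₁))) * ((L ^ j)⁻¹) ^ 2 * a')) := by
  unfold V₂op
  have h1 := norm_sum_sBracket₂_le_printed T U hη hL hU hU' A A' hA ha hA' hdA hg hdA' μ x
  have h2 := norm_F₂op_le_printed T U hη hL hU hU' A A' hA ha hA' μ x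
  exact (norm_add_le_of_le h1 h2).trans (le_of_eq (by ring))

end Bounds

/-! ## §5  Sanity -/

section Examples

variable {𝔸 : Type*} [NormedRing 𝔸] [NormedAlgebra ℂ 𝔸] [CompleteSpace 𝔸] {S : Type*} {ι : Type*}
variable (T : ι → Equiv.Perm S) (U : ι → S → 𝔸ˣ)

/-- No fluctuation field, no correction: at `A = 0` the bracket and the higher-order terms vanish … -/
example (η : ℝ) (A' : ι → S → 𝔸) (ν μ : ι) (x : S) : sBracket₂ T U η 0 A' ν μ x = 0 := by
  simp [sBracket₂, covDstar, covD]

example (η : ℝ) (A' : ι → S → 𝔸) (ν μ : ι) (x : S) : fRem₂ T U η 0 A' ν μ x = 0 := by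
  simp [fRem₂, divE₁, divE₂, conjRem, covD]

example [Fintype ι] (η : ℝ) (A' : ι → S → 𝔸) (μ : ι) (x : S) : V₂op T U η 0 A' μ x = 0 := by
  simp [V₂op, F₂op, sBracket₂, fRem₂, divE₁, divE₂, conjRem, covD, covDstar]

/-- … consistently with `prodCfg U η 0 = U` (`B9Eq369Product.prodCfg_zero`) in (3.75). -/
example [Fintype ι] (η : ℝ) (A' : ι → S → 𝔸) (μ : ι) (x : S) : gradDiv T (prodCfg U η 0) A' μ x = gradDiv T U A' μ x := by
  rw [prodCfg_zero]

/-- Over a commutative carrier the first-order operator vanishes identically (`V₂`'s first order is a sum of commutators). -/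
example {𝔹 : Type*} [NormedCommRing 𝔹] [NormedAlgebra ℂ 𝔹] (T : ι → Equiv.Perm S) (U : ι → S → 𝔹ˣ) (η : ℝ)
    (A A' : ι → S → 𝔹) (ν μ : ι) (x : S) : sBracket₂ T U η A A' ν μ x = 0 := by
  simp [sBracket₂, mul_comm]

end Examples

end Literature.MathematicalPhysics.QuantumFieldTheory.Balaban1983to89.B9Eq375Composition

end
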